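import Mathlib.Topology.Algebra.OpenSubgroup
import Mathlib.Topology.Homeomorph.Lemmas
import Mathlib.GroupTheory.Index
import Literature.AnabelianGeometry.SemiGraphs.Coverticial
import HarnessLib

/-!
# Pro-`Σ` completions of discrete groups, IV: transport along isomorphisms of topological groups

Over abc-iut-L3-t1's interface `SemiGraphOfAnabelioids.IsProSigmaCompletion Sigma ι` ([SemiAnbd]
Example 2.10, "the maximal pro-`Σ` quotient", p. 31) [cite: MochizukiSemiAnbd2006, Ex. 2.10 p.31].
Theorems only, no definitions (abc-iut cell, layer L3, glue for row W4-11 «surface type is stable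
under finite étale coverings»).  Companion of `ProSigmaCompletionRestrict.lean` (part III: restriction
to an OPEN SUBGROUP `H ⊆ P`); this part supplies the transport from the subgroup `H` to a topological
group `P'` that is merely ISOMORPHIC to it — the situation of [SemiAnbd] Remark 2.2.1 / Example 2.10,
where `Π_{v'} = Aut F'` is identified with the open point-stabiliser in `Π_v = Aut F` only through the
injective continuous homomorphism `π₁(φ)` (`Anabelioids.range_pi1Map_eq_stabilizer`), not literally
as a subgroup.

* `of_target_mulEquiv` — if `κ : Γ → Q` is a pro-`Σ` completion and `e : Q' ≃* Q` is a group
  isomorphism with `e` and `e⁻¹` continuous, then every `ι' : Γ → Q'` with `e ∘ ι' = κ` is a pro-`Σ`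
  completion;
* `of_continuous_injective` — the form the W4-11 assembly consumes: `κ : Γ → H` a pro-`Σ`
  completion onto a subgroup `H` of a Hausdorff group `P`, `j : P' → P` a continuous INJECTIVE
  homomorphism from a compact group with `range j = H`, and `ι' : Γ → P'` with `j ∘ ι' = κ` (as maps
  to `P`); then `ι'` is a pro-`Σ` completion.  (A continuous bijection from a
  compact space onto a Hausdorff space is a homeomorphism — Mathlib
  `Continuous.homeoOfEquivCompactToT2` —, so this reduces to `of_target_mulEquiv`.)

No statement here takes a side on [IUTchIII] Cor. 3.12; this is plain (pro)finite group theory.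
-/

namespace Literature.AnabelianGeometry.SemiGraphs.SemiGraphOfAnabelioids.IsProSigmaCompletion

open Literature.AnabelianGeometry.Anabelioids Topology

variable {Sigma : Set ℕ} {Γ : Type*} [Group Γ]

/-! ### Transport along an isomorphism of the TARGET -/

section Target

variable {Q : Type*} [Group Q] [TopologicalSpace Q] {Q' : Type*} [Group Q'] [TopologicalSpace Q']
  {κ : Γ →* Q} {ι' : Γ →* Q'}

/-- **Transport of `IsProSigmaCompletion` along an isomorphism of topological groups (target).**  Let
`κ : Γ → Q` exhibit `Q` as the pro-`Σ` completion of `Γ`, and let `e : Q' ≃* Q` be a group isomorphism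
such that `e` and `e.symm` are continuous.  Then any `ι' : Γ → Q'` with `e (ι' x) = κ x` exhibits `Q'`
as the pro-`Σ` completion of `Γ`.  (Dense image: `ι' = e⁻¹ ∘ κ` with `e⁻¹` a continuous surjection;
open normal subgroups of `Q'` pull back from those of `Q` along `e⁻¹` with the same index; an open
`U ⊆ Q` with `κ⁻¹(U) = N` gives the open `e⁻¹(U) ⊆ Q'` with `ι'⁻¹(e⁻¹ U) = N`.)
[cite: MochizukiSemiAnbd2006, Ex. 2.10 p.31] -/
theorem of_target_mulEquiv (hκ : IsProSigmaCompletion Sigma κ) (e : Q' ≃* Q) (he : Continuous e)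
    (hes : Continuous e.symm) (h : ∀ x, e (ι' x) = κ x) : IsProSigmaCompletion Sigma ι' where
  dense := by
    have hfun : (ι' : Γ → Q') = e.symm ∘ κ := by
      funext x
      rw [Function.comp_apply, ← h x, e.symm_apply_apply]
    change DenseRange ι'
    rw [hfun]
    exact e.symm.surjective.denseRange.comp hκ.dense hes
  index_open N hNn hNo := by
    haveI := hNn
    have hopen : IsOpen ((N.comap e.symm.toMonoidHom : Subgroup Q) : Set Q) := hNo.preimage hes
    haveI : (N.comap e.symm.toMonoidHom).Normal := Subgroup.Normal.comap hNn _
    have h1 := hκ.index_open (N.comap e.symm.toMonoidHom) inferInstance hopen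
    rwa [Subgroup.index_comap_of_surjective _ e.symm.surjective] at h1
  comap_surj N hNn hN := by
    obtain ⟨U, hUo, hU⟩ := hκ.comap_surj N hNn hN
    refine ⟨U.comap e.toMonoidHom, hUo.preimage he, ?_⟩
    ext x
    rw [Subgroup.mem_comap, Subgroup.mem_comap, MulEquiv.coe_toMonoidHom, h x, ← Subgroup.mem_comap,
      hU]

/-- Transport along a `ContinuousMulEquiv` of the target, composition form.
[cite: MochizukiSemiAnbd2006, Ex. 2.10 p.31] -/
theorem comp_continuousMulEquiv (hκ : IsProSigmaCompletion Sigma κ) (e : Q ≃ₜ* Q') :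
    IsProSigmaCompletion Sigma ((e.toMulEquiv.toMonoidHom).comp κ) :=
  of_target_mulEquiv hκ e.toMulEquiv.symm e.symm.continuous e.continuous fun x =>
    e.toMulEquiv.symm_apply_apply (κ x)

end Target

/-! ### The form consumed by [SemiAnbd] Example 2.10: an injective continuous homomorphism with open range -/

section Embedding

variable {P : Type*} [Group P] [TopologicalSpace P] [T2Space P]
  {P' : Type*} [Group P'] [TopologicalSpace P'] [CompactSpace P']
  {Γ' : Type*} [Group Γ']

/-- **Transport to an isomorphic copy of a subgroup.**  Let `P` be a Hausdorff topological group,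
`H ⊆ P` a subgroup (in the application: OPEN, `P` profinite), `κ : Γ' → H` a pro-`Σ` completion (e.g.
the restriction of `ProSigmaCompletionRestrict.lean`), `j : P' → P` a CONTINUOUS INJECTIVE homomorphism
from a COMPACT group `P'` with `range j = H` (for [SemiAnbd] Example 2.10: `j = π₁(φ) : Π_{v'} ↪ Π_v`
onto the point stabiliser, `Anabelioids.range_pi1Map_eq_stabilizer`), and `ι' : Γ' → P'` with
`j (ι' x) = κ x`.  Then `ι'` exhibits `P'` as the pro-`Σ` completion of `Γ'`.  (`j` co-restricts to a
continuous bijection `P' → H` of a compact space onto a Hausdorff space, hence a homeomorphism.)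
[cite: MochizukiSemiAnbd2006, Ex. 2.10 p.31] -/
theorem of_continuous_injective (H : Subgroup P) {κ : Γ' →* H}
    (hκ : IsProSigmaCompletion Sigma κ) (j : P' →* P) (hjc : Continuous j)
    (hji : Function.Injective j) (hjH : j.range = H) (ι' : Γ' →* P')
    (h : ∀ x, j (ι' x) = ((κ x : H) : P)) : IsProSigmaCompletion Sigma ι' := by
  -- the co-restriction `e₀ : P' ≃* H` of `j`
  let e₀ : P' ≃* H := (MonoidHom.ofInjective hji).trans (MulEquiv.subgroupCongr hjH)
  have he₀_apply : ∀ y : P', ((e₀ y : H) : P) = j y := fun y => rfl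
  have he₀c : Continuous e₀ := by
    apply Continuous.subtype_mk
    exact hjc
  -- a continuous bijection from a compact space onto a Hausdorff space is a homeomorphism
  let φ : P' ≃ₜ H := Continuous.homeoOfEquivCompactToT2 (f := e₀.toEquiv) he₀c
  have hes : Continuous e₀.symm := φ.symm.continuous
  refine of_target_mulEquiv hκ e₀ he₀c hes fun x => ?_
  apply Subtype.ext
  rw [he₀_apply]
  exact h x

end Embedding

end Literature.AnabelianGeometry.SemiGraphs.SemiGraphOfAnabelioids.IsProSigmaCompletion
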